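import Literature.Analysis.PDE.MaxRegEstimate
import HarnessLib

/-!
# The linear a priori estimate with explicit source constant and sub-slab uniformity (topic `Analysis/PDE`)

Variants of `PatchResidualEnergy.lean` / `LinApriori.lean` / `MaxRegEstimate.lean` needed by the
quasilinear Picard scheme (hypothesis `hQL` of
`Literature.Geometry.Riemannian.ricciFlow_shortTime_existence_of_quasilinear`), where the
boundedness of the iteration at all orders on one time interval rests on two structural facts of
the weighted a priori estimate `Σ_p maxRegQ_i ≤ C Σ_p ∫ e^{-2λs} E_i(cutExpr_p g)`:

* the constant `C` in front of the source is a numeral times geometric data, the same for every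
  order `i` (`C = 32 (n + 2) |ι|`), and
* `Λ, C` obtained from the coefficient data on `[0, T]` serve every sub-slab `[0, T']`, `T' ≤ T`.

Both are visible in the original proofs; this file restates the chain with the constant explicit:
`sobolevEnergy_low_le_explicit`, `sobolevEnergy_residual_le_explicit`,
`sobolevEnergy_slabResidual_le_explicit`, `linear_apriori_residual_le_explicit`,
`maxreg_apriori_le_explicit`.

Everything is proved; no named fact and no `sorry` is introduced.

## References

* L. C. Evans, *Partial Differential Equations*, 2nd ed., AMS 2010, §7.1.3. [Evans2010]
-/

noncomputable section

open Set Function Filter Topology Metric MeasureTheory InnerProductSpace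
open scoped Manifold ContDiff Topology ENNReal RealInnerProductSpace Laplacian

namespace Literature.Analysis.PDE

open Literature.Geometry.Manifold Literature.Analysis.FunctionSpaces Literature.Analysis.FluidPDE

variable {E : Type*} [NormedAddCommGroup E] [NormedSpace ℝ E] {H : Type*} [TopologicalSpace H]
variable {I : ModelWithCorners ℝ E H} {M : Type*} [TopologicalSpace M] [ChartedSpace H M]
variable {E' : Type*} [NormedAddCommGroup E'] [InnerProductSpace ℝ E'] [FiniteDimensional ℝ E']
variable {F' : Type*} [NormedAddCommGroup F'] [InnerProductSpace ℝ F']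
variable {ι : Type*} [Fintype ι] (P : PatchSystem I M E' ι)

namespace PatchSystemLoc

section LowEnergy

variable [MeasurableSpace E'] [BorelSpace E'] [IsManifold I ∞ M] [I.Boundaryless] [T2Space M]

/-- **The lower-order part of the residual, bounded through all patches**: for every `i` there
are `C_low, C_g < ∞` (depending on the patch system, `p`, `i` only) such that for all data —
`f` with smooth chart expressions, `g`, coefficient slices whose cut-off coefficient fields are
smooth and bounded by `Mc` together with their word derivatives up to order `i` —
`E_i(LOW) ≤ C_low (Mc² + 1) Σ_q (E_i(w_q) + Σ_m E_i(∂_m w_q)) + C_g E_i(cutExpr P p g)` with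
`LOW = -lowerSymbol (S-1) cut u + cut • (𝔟(Du) + 𝔠u + g∘κ_p⁻¹) - 2Σₗ ∂ₗcut • ∂ₗu - Δcut • u`,
`u = f ∘ κ_p⁻¹`. [cite: Evans2010, §7.1.3] -/
theorem sobolevEnergy_low_le_explicit (p : ι) (i : ℕ) :
    ∃ Clow : ℝ≥0∞, Clow ≠ ⊤ ∧
      ∀ {f g : M → F'} {Ss : E' → (E' →L[ℝ] E')} {𝔟s : E' → ((E' →L[ℝ] F') →L[ℝ] F')}
        {𝔠s : E' → (F' →L[ℝ] F')} {Mc : ℝ},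
      (∀ q, ContDiffOn ℝ ∞ (f ∘ (P.chart q).inv) (P.chart q).target) →
      ContDiffOn ℝ ∞ (g ∘ (P.chart p).inv) (P.chart p).target →
      (∀ k l, ContDiff ℝ ∞ (topCoeff P p Ss k l)) → (∀ l, ContDiff ℝ ∞ (firstCoeff P p 𝔟s l)) →
      ContDiff ℝ ∞ (zeroCoeff P p 𝔠s) →
      (∀ k l y, |topCoeff P p Ss k l y| ≤ Mc) →
      (∀ k l, ∀ lst : List (Fin (Module.finrank ℝ E')), lst ≠ [] → lst.length ≤ i →
        ∀ y, ‖iterDirDeriv (lst.map (stdOrthonormalBasis ℝ E')) (topCoeff P p Ss k l) y‖ ≤ Mc) →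
      (∀ l y, ‖firstCoeff P p 𝔟s l y‖ ≤ Mc) →
      (∀ l, ∀ lst : List (Fin (Module.finrank ℝ E')), lst ≠ [] → lst.length ≤ i →
        ∀ y, ‖iterDirDeriv (lst.map (stdOrthonormalBasis ℝ E')) (firstCoeff P p 𝔟s l) y‖ ≤ Mc) →
      (∀ y, ‖zeroCoeff P p 𝔠s y‖ ≤ Mc) →
      (∀ lst : List (Fin (Module.finrank ℝ E')), lst ≠ [] → lst.length ≤ i →
        ∀ y, ‖iterDirDeriv (lst.map (stdOrthonormalBasis ℝ E')) (zeroCoeff P p 𝔠s) y‖ ≤ Mc) →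
      sobolevEnergy i (fun y ↦
          -lowerSymbol (Ss y - 1) (P.cut p) (f ∘ (P.chart p).inv) y +
          P.cut p y • (𝔟s y (fderiv ℝ (f ∘ (P.chart p).inv) y) + 𝔠s y ((f ∘ (P.chart p).inv) y) +
            g ((P.chart p).inv y)) -
          (2 • ∑ l, fderiv ℝ (P.cut p) y (stdOrthonormalBasis ℝ E' l) •
            fderiv ℝ (f ∘ (P.chart p).inv) y (stdOrthonormalBasis ℝ E' l)) -
          (Δ (⇑(P.cut p))) y • (f ∘ (P.chart p).inv) y) ≤
        Clow * ENNReal.ofReal (Mc ^ 2 + 1) *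
            ∑ q, (sobolevEnergy i (cutExpr P q f) +
              ∑ m, sobolevEnergy i (fun y ↦ fderiv ℝ (cutExpr P q f) y (stdOrthonormalBasis ℝ E' m))) +
          8 * sobolevEnergy i (cutExpr P p g) := by
  classical
  set b := stdOrthonormalBasis ℝ E'
  -- the cut-off, its derived multipliers and their common compact support
  have hcs : ContDiff ℝ ∞ (P.cut p) := (P.cut p).contDiff
  have hct : tsupport (P.cut p) ⊆ (P.chart p).target := P.tsupport_cut_subset p
  have hCθ : IsCompact (tsupport (P.cut p)) := by
    rw [ContDiffBump.tsupport_eq]; exact isCompact_closedBall _ _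
  have hθ₁s : ∀ k, ContDiff ℝ ∞ fun y ↦ fderiv ℝ (P.cut p) y (b k) := fun k ↦
    contDiff_fderiv_apply_of_contDiff hcs (b k)
  have hθ₁t : ∀ k, tsupport (fun y ↦ fderiv ℝ (P.cut p) y (b k)) ⊆ tsupport (P.cut p) := fun k ↦
    tsupport_fderiv_apply_subset ℝ (b k)
  have hθ₂s : ∀ k l, ContDiff ℝ ∞ fun y ↦ fderiv ℝ (fun z ↦ fderiv ℝ (P.cut p) z (b l)) y (b k) := fun k l ↦
    contDiff_fderiv_apply_of_contDiff (hθ₁s l) (b k)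
  have hθ₂t : ∀ k l, tsupport (fun y ↦ fderiv ℝ (fun z ↦ fderiv ℝ (P.cut p) z (b l)) y (b k)) ⊆
      tsupport (P.cut p) := fun k l ↦ (tsupport_fderiv_apply_subset ℝ (b k)).trans (hθ₁t l)
  have hθ₃s : ContDiff ℝ ∞ (Δ (⇑(P.cut p))) := contDiff_laplacian_of_contDiff hcs
  have hθ₃t : tsupport (Δ (⇑(P.cut p))) ⊆ tsupport (P.cut p) := by
    refine closure_minimal (fun y hy ↦ ?_) (isClosed_tsupport _)
    by_contra h
    exact hy (laplacian_cut_eq_zero P p h)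
  -- transport constants from `PatchLowerOrder`
  obtain ⟨C₀, hC₀top, hC₀⟩ := sobolevEnergy_smul_comp_inv_le (F := F') P p hcs hCθ hct Subset.rfl i
  have h1 : ∀ k l, ∃ C : ℝ≥0∞, C ≠ ⊤ ∧ ∀ {f : M → F'},
      (∀ q, ContDiffOn ℝ ∞ (f ∘ (P.chart q).inv) (P.chart q).target) →
      sobolevEnergy i (fun y ↦ fderiv ℝ (P.cut p) y (b k) • fderiv ℝ (f ∘ (P.chart p).inv) y (b l)) ≤
        C * ∑ q, (sobolevEnergy i (cutExpr P q f) +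
          ∑ m, sobolevEnergy i (fun y ↦ fderiv ℝ (cutExpr P q f) y (b m))) :=
    fun k l ↦ sobolevEnergy_smul_fderiv_comp_inv_le (F := F') P p (hθ₁s k) hCθ hct (hθ₁t k) (b l) i
  choose C₁ hC₁top hC₁ using h1
  have h1' : ∀ l, ∃ C : ℝ≥0∞, C ≠ ⊤ ∧ ∀ {f : M → F'},
      (∀ q, ContDiffOn ℝ ∞ (f ∘ (P.chart q).inv) (P.chart q).target) →
      sobolevEnergy i (fun y ↦ P.cut p y • fderiv ℝ (f ∘ (P.chart p).inv) y (b l)) ≤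
        C * ∑ q, (sobolevEnergy i (cutExpr P q f) +
          ∑ m, sobolevEnergy i (fun y ↦ fderiv ℝ (cutExpr P q f) y (b m))) :=
    fun l ↦ sobolevEnergy_smul_fderiv_comp_inv_le (F := F') P p hcs hCθ hct Subset.rfl (b l) i
  choose C₁' hC₁'top hC₁' using h1'
  have h2 : ∀ k l, ∃ C : ℝ≥0∞, C ≠ ⊤ ∧ ∀ {f : M → F'},
      (∀ q, ContDiffOn ℝ ∞ (f ∘ (P.chart q).inv) (P.chart q).target) →
      sobolevEnergy i (fun y ↦ fderiv ℝ (fun z ↦ fderiv ℝ (P.cut p) z (b l)) y (b k) •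
          f ((P.chart p).inv y)) ≤ C * ∑ q, sobolevEnergy i (cutExpr P q f) :=
    fun k l ↦ sobolevEnergy_smul_comp_inv_le (F := F') P p (hθ₂s k l) hCθ hct (hθ₂t k l) i
  choose C₂ hC₂top hC₂ using h2
  obtain ⟨C₃, hC₃top, hC₃⟩ := sobolevEnergy_smul_comp_inv_le (F := F') P p hθ₃s hCθ hct hθ₃t i
  -- Leibniz constants
  obtain ⟨Cdd, hCddtop, hCdd⟩ := sobolevEnergy_sum_sum_smul_le (F' := F') (E' := E') i
  obtain ⟨Ccl, hCcltop, hCcl⟩ := sobolevEnergy_clm_apply_le_crude (E := E') (F := F') (G := F') i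
  -- total constants
  set S₁ : ℝ≥0∞ := ∑ k, ∑ l, C₁ k l with hS₁
  set S₁' : ℝ≥0∞ := ∑ l, C₁' l with hS₁'
  set S₂ : ℝ≥0∞ := ∑ k, ∑ l, C₂ k l with hS₂
  set A : ℝ≥0∞ := Cdd * (S₁ + S₁ + S₂) + (Module.finrank ℝ E' : ℝ≥0∞) * Ccl * S₁' + Ccl * C₀ with hA
  set B : ℝ≥0∞ := 4 * (Module.finrank ℝ E' : ℝ≥0∞) * S₁ + C₃ with hB
  have hS₁top : S₁ ≠ ⊤ := ENNReal.sum_ne_top.2 fun k _ ↦ ENNReal.sum_ne_top.2 fun l _ ↦ hC₁top k l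
  have hS₁'top : S₁' ≠ ⊤ := ENNReal.sum_ne_top.2 fun l _ ↦ hC₁'top l
  have hS₂top : S₂ ≠ ⊤ := ENNReal.sum_ne_top.2 fun k _ ↦ ENNReal.sum_ne_top.2 fun l _ ↦ hC₂top k l
  have hntop : (Module.finrank ℝ E' : ℝ≥0∞) ≠ ⊤ := ENNReal.natCast_ne_top _
  have hAtop : A ≠ ⊤ := by
    rw [hA]
    exact ENNReal.add_ne_top.2 ⟨ENNReal.add_ne_top.2 ⟨ENNReal.mul_ne_top hCddtop
      (ENNReal.add_ne_top.2 ⟨ENNReal.add_ne_top.2 ⟨hS₁top, hS₁top⟩, hS₂top⟩),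
      ENNReal.mul_ne_top (ENNReal.mul_ne_top hntop hCcltop) hS₁'top⟩, ENNReal.mul_ne_top hCcltop hC₀top⟩
  have hBtop : B ≠ ⊤ := by
    rw [hB]
    exact ENNReal.add_ne_top.2 ⟨ENNReal.mul_ne_top (ENNReal.mul_ne_top (by norm_num) hntop) hS₁top, hC₃top⟩
  refine ⟨8 * (A + B), ENNReal.mul_ne_top (by norm_num) (ENNReal.add_ne_top.2 ⟨hAtop, hBtop⟩), ?_⟩
  intro f g Ss 𝔟s 𝔠s Mc hf hg ha hBf hCf ha0 haw hB0 hBw hC0 hCw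
  -- abbreviations
  set u : E' → F' := f ∘ (P.chart p).inv with hu
  have huV : ContDiffOn ℝ ∞ u (P.chart p).target := hf p
  have huV' : ∀ l, ContDiffOn ℝ ∞ (fun y ↦ fderiv ℝ u y (b l)) (P.chart p).target := fun l ↦
    contDiffOn_fderiv_apply_of_isOpen (P.chart p).isOpen_target huV (b l)
  set TOT : ℝ≥0∞ := ∑ q, (sobolevEnergy i (cutExpr P q f) +
    ∑ m, sobolevEnergy i (fun y ↦ fderiv ℝ (cutExpr P q f) y (b m))) with hTOT
  have hTOT0 : ∑ q, sobolevEnergy i (cutExpr P q f) ≤ TOT := Finset.sum_le_sum fun q _ ↦ le_self_add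
  have hV := (P.chart p).isOpen_target
  -- the globally smooth building blocks
  have hW₁ : ∀ k l, ContDiff ℝ ∞ fun y ↦ fderiv ℝ (P.cut p) y (b k) • fderiv ℝ u y (b l) := fun k l ↦
    contDiff_smul_of_tsupport_subset hV (hθ₁s k) ((hθ₁t k).trans hct) (huV' l)
  have hW₃ : ∀ k l, ContDiff ℝ ∞ fun y ↦
      fderiv ℝ (fun z ↦ fderiv ℝ (P.cut p) z (b l)) y (b k) • u y := fun k l ↦
    contDiff_smul_of_tsupport_subset hV (hθ₂s k l) ((hθ₂t k l).trans hct) huV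
  have hW₄ : ∀ l, ContDiff ℝ ∞ fun y ↦ P.cut p y • fderiv ℝ u y (b l) := fun l ↦
    contDiff_smul_of_tsupport_subset hV hcs hct (huV' l)
  have hW₅ : ContDiff ℝ ∞ fun y ↦ P.cut p y • u y := contDiff_smul_of_tsupport_subset hV hcs hct huV
  have hW₈ : ContDiff ℝ ∞ fun y ↦ (Δ (⇑(P.cut p))) y • u y :=
    contDiff_smul_of_tsupport_subset hV hθ₃s (hθ₃t.trans hct) huV
  have hw : ∀ q, ContDiff ℝ ∞ (cutExpr P q f) := fun q ↦ contDiff_cutExpr P (hf q)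
  have hwg : ContDiff ℝ ∞ (cutExpr P p g) := contDiff_cutExpr P hg
  -- the eight terms as opaque functions
  obtain ⟨T₁, hT₁⟩ : ∃ T₁ : E' → F', T₁ = fun y ↦ ∑ k, ∑ l, topCoeff P p Ss k l y •
      (fderiv ℝ (P.cut p) y (b k) • fderiv ℝ u y (b l)) := ⟨_, rfl⟩
  obtain ⟨T₂, hT₂⟩ : ∃ T₂ : E' → F', T₂ = fun y ↦ ∑ k, ∑ l, topCoeff P p Ss k l y •
      (fderiv ℝ (P.cut p) y (b l) • fderiv ℝ u y (b k)) := ⟨_, rfl⟩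
  obtain ⟨T₃, hT₃⟩ : ∃ T₃ : E' → F', T₃ = fun y ↦ ∑ k, ∑ l, topCoeff P p Ss k l y •
      (fderiv ℝ (fun z ↦ fderiv ℝ (P.cut p) z (b l)) y (b k) • u y) := ⟨_, rfl⟩
  obtain ⟨T₄, hT₄⟩ : ∃ T₄ : E' → F', T₄ = fun y ↦ ∑ l, firstCoeff P p 𝔟s l y
      (P.cut p y • fderiv ℝ u y (b l)) := ⟨_, rfl⟩
  obtain ⟨T₅, hT₅⟩ : ∃ T₅ : E' → F', T₅ = fun y ↦ zeroCoeff P p 𝔠s y (P.cut p y • u y) := ⟨_, rfl⟩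
  obtain ⟨T₇, hT₇⟩ : ∃ T₇ : E' → F', T₇ = fun y ↦ ∑ l, fderiv ℝ (P.cut p) y (b l) • fderiv ℝ u y (b l) :=
    ⟨_, rfl⟩
  obtain ⟨T₈, hT₈⟩ : ∃ T₈ : E' → F', T₈ = fun y ↦ (Δ (⇑(P.cut p))) y • u y := ⟨_, rfl⟩
  -- smoothness of the terms
  have hT₁s : ContDiff ℝ ∞ T₁ := by
    rw [hT₁]; exact ContDiff.sum fun k _ ↦ ContDiff.sum fun l _ ↦ (ha k l).smul (hW₁ k l)
  have hT₂s : ContDiff ℝ ∞ T₂ := by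
    rw [hT₂]; exact ContDiff.sum fun k _ ↦ ContDiff.sum fun l _ ↦ (ha k l).smul (hW₁ l k)
  have hT₃s : ContDiff ℝ ∞ T₃ := by
    rw [hT₃]; exact ContDiff.sum fun k _ ↦ ContDiff.sum fun l _ ↦ (ha k l).smul (hW₃ k l)
  have hT₄s : ContDiff ℝ ∞ T₄ := by
    rw [hT₄]; exact ContDiff.sum fun l _ ↦ (hBf l).clm_apply (hW₄ l)
  have hT₅s : ContDiff ℝ ∞ T₅ := by rw [hT₅]; exact hCf.clm_apply hW₅
  have hT₇s : ContDiff ℝ ∞ T₇ := by rw [hT₇]; exact ContDiff.sum fun l _ ↦ hW₁ l l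
  have hT₈s : ContDiff ℝ ∞ T₈ := by rw [hT₈]; exact hW₈
  -- Step 1: the function is `-T₁ - T₂ - T₃ + T₄ + T₅ + T₆ - 2T₇ - T₈`, written as a sum over `Fin 8`
  set TT : Fin 8 → E' → F' := ![fun y ↦ -T₁ y, fun y ↦ -T₂ y, fun y ↦ -T₃ y, T₄, T₅, cutExpr P p g,
    fun y ↦ (-2 : ℝ) • T₇ y, fun y ↦ -T₈ y] with hTT
  have hTTs : ∀ j, ContDiff ℝ ∞ (TT j) := by
    intro j
    fin_cases j
    · exact hT₁s.neg
    · exact hT₂s.neg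
    · exact hT₃s.neg
    · exact hT₄s
    · exact hT₅s
    · exact hwg
    · exact hT₇s.const_smul _
    · exact hT₈s.neg
  have hsplit : (fun y ↦ -lowerSymbol (Ss y - 1) (P.cut p) u y +
        P.cut p y • (𝔟s y (fderiv ℝ u y) + 𝔠s y (u y) + g ((P.chart p).inv y)) -
        (2 • ∑ l, fderiv ℝ (P.cut p) y (b l) • fderiv ℝ u y (b l)) - (Δ (⇑(P.cut p))) y • u y) =
      fun y ↦ ∑ j, TT j y := by
    funext y
    rw [low_split P p Ss 𝔟s 𝔠s u g y, Fin.sum_univ_eight]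
    have e1 := sum_sum_inner_smul_eq_topCoeff (F' := F') P p Ss
      (s := fun k _ y ↦ fderiv ℝ (P.cut p) y (b k))
      (fun k l y hy ↦ by simp [fderiv_cut_eq_zero P p hy]) (fun k l y ↦ fderiv ℝ u y (b l)) y
    have e2 := sum_sum_inner_smul_eq_topCoeff (F' := F') P p Ss
      (s := fun _ l y ↦ fderiv ℝ (P.cut p) y (b l))
      (fun k l y hy ↦ by simp [fderiv_cut_eq_zero P p hy]) (fun k l y ↦ fderiv ℝ u y (b k)) y
    have e3 := sum_sum_inner_smul_eq_topCoeff (F' := F') P p Ss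
      (s := fun k l y ↦ fderiv ℝ (fun z ↦ fderiv ℝ (P.cut p) z (b l)) y (b k))
      (fun k l y hy ↦ by simp [fderiv_fderiv_cut_eq_zero P p hy]) (fun _ _ y ↦ u y) y
    have e4 := cut_smul_first_eq_sum_firstCoeff P p 𝔟s u y
    have e5 := cut_smul_zero_eq_zeroCoeff P p 𝔠s u y
    simp only [hTT, hT₁, hT₂, hT₃, hT₄, hT₅, hT₇, hT₈, Matrix.cons_val_zero, Matrix.cons_val_one,
      Matrix.head_cons, Matrix.cons_val_two, Matrix.tail_cons, Matrix.cons_val_three,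
      Matrix.cons_val_four, Matrix.cons_val]
    rw [e1, e2, e3, e4, e5]
    simp only [neg_smul]
    abel
  -- Step 2: the energy of the sum
  rw [hsplit]
  have hsum : sobolevEnergy i (fun y ↦ ∑ j, TT j y) ≤ 8 * ∑ j, sobolevEnergy i (TT j) := by
    have h := sobolevEnergy_sum_le_card i (Finset.univ : Finset (Fin 8)) (f := TT)
      fun j _ ↦ (hTTs j).of_le (by exact_mod_cast le_top)
    simpa using h
  refine hsum.trans ?_
  rw [Fin.sum_univ_eight]
  simp only [hTT, Matrix.cons_val_zero, Matrix.cons_val_one, Matrix.head_cons, Matrix.cons_val_two,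
    Matrix.tail_cons, Matrix.cons_val_three, Matrix.cons_val_four, Matrix.cons_val]
  -- Step 3: the individual bounds
  have hMc2 : ENNReal.ofReal (Mc ^ 2) ≤ ENNReal.ofReal (Mc ^ 2 + 1) := ENNReal.ofReal_le_ofReal (by linarith)
  have bT₁ : sobolevEnergy i (fun y ↦ -T₁ y) ≤ Cdd * ENNReal.ofReal (Mc ^ 2) * (S₁ * TOT) := by
    rw [sobolevEnergy_neg' i hT₁s, hT₁]
    refine (hCdd ha (fun k l ↦ hW₁ k l) ha0 haw).trans (mul_le_mul' le_rfl ?_)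
    rw [hS₁, Finset.sum_mul]
    refine Finset.sum_le_sum fun k _ ↦ ?_
    rw [Finset.sum_mul]
    exact Finset.sum_le_sum fun l _ ↦ hC₁ k l hf
  have bT₂ : sobolevEnergy i (fun y ↦ -T₂ y) ≤ Cdd * ENNReal.ofReal (Mc ^ 2) * (S₁ * TOT) := by
    rw [sobolevEnergy_neg' i hT₂s, hT₂]
    refine (hCdd ha (fun k l ↦ hW₁ l k) ha0 haw).trans (mul_le_mul' le_rfl ?_)
    rw [hS₁, Finset.sum_mul, Finset.sum_comm]
    refine Finset.sum_le_sum fun l _ ↦ ?_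
    rw [Finset.sum_mul]
    exact Finset.sum_le_sum fun k _ ↦ hC₁ l k hf
  have bT₃ : sobolevEnergy i (fun y ↦ -T₃ y) ≤ Cdd * ENNReal.ofReal (Mc ^ 2) * (S₂ * TOT) := by
    rw [sobolevEnergy_neg' i hT₃s, hT₃]
    refine (hCdd ha (fun k l ↦ hW₃ k l) ha0 haw).trans (mul_le_mul' le_rfl ?_)
    rw [hS₂, Finset.sum_mul]
    refine Finset.sum_le_sum fun k _ ↦ ?_
    rw [Finset.sum_mul]
    exact Finset.sum_le_sum fun l _ ↦ (hC₂ k l hf).trans (mul_le_mul' le_rfl hTOT0)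
  have bT₄ : sobolevEnergy i T₄ ≤ (Module.finrank ℝ E' : ℝ≥0∞) * Ccl * ENNReal.ofReal (Mc ^ 2) * (S₁' * TOT) := by
    rw [hT₄]
    have hsm : ∀ l, ContDiff ℝ i fun y ↦ firstCoeff P p 𝔟s l y (P.cut p y • fderiv ℝ u y (b l)) :=
      fun l ↦ ((hBf l).clm_apply (hW₄ l)).of_le (by exact_mod_cast le_top)
    calc sobolevEnergy i (fun y ↦ ∑ l, firstCoeff P p 𝔟s l y (P.cut p y • fderiv ℝ u y (b l)))
        ≤ (Finset.univ.card : ℝ≥0∞) * ∑ l, sobolevEnergy i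
            (fun y ↦ firstCoeff P p 𝔟s l y (P.cut p y • fderiv ℝ u y (b l))) :=
          sobolevEnergy_sum_le_card i Finset.univ fun l _ ↦ hsm l
      _ ≤ (Module.finrank ℝ E' : ℝ≥0∞) * ∑ l, Ccl * ENNReal.ofReal (Mc ^ 2) * (C₁' l * TOT) := by
          rw [Finset.card_univ, Fintype.card_fin]
          refine mul_le_mul' le_rfl (Finset.sum_le_sum fun l _ ↦ ?_)
          exact (hCcl (hBf l) (hW₄ l) (hB0 l) (hBw l)).trans (mul_le_mul' le_rfl (hC₁' l hf))
      _ = (Module.finrank ℝ E' : ℝ≥0∞) * Ccl * ENNReal.ofReal (Mc ^ 2) * (S₁' * TOT) := by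
          rw [hS₁', Finset.sum_mul, Finset.mul_sum, Finset.mul_sum]
          refine Finset.sum_congr rfl fun l _ ↦ ?_
          ring
  have bT₅ : sobolevEnergy i T₅ ≤ Ccl * ENNReal.ofReal (Mc ^ 2) * (C₀ * TOT) := by
    rw [hT₅]
    exact (hCcl hCf hW₅ hC0 hCw).trans (mul_le_mul' le_rfl ((hC₀ hf).trans (mul_le_mul' le_rfl hTOT0)))
  have bT₇ : sobolevEnergy i (fun y ↦ (-2 : ℝ) • T₇ y) ≤ 4 * ((Module.finrank ℝ E' : ℝ≥0∞) * (S₁ * TOT)) := by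
    rw [sobolevEnergy_const_smul i (hT₇s.of_le (by exact_mod_cast le_top)), hT₇]
    have h4 : ‖(-2 : ℝ)‖ₑ ^ 2 = 4 := by
      rw [← ofReal_norm, norm_neg, Real.norm_eq_abs, abs_two, ← ENNReal.ofReal_pow zero_le_two]
      norm_num
    rw [h4]
    refine mul_le_mul' le_rfl ?_
    have hsm : ∀ l, ContDiff ℝ i fun y ↦ fderiv ℝ (P.cut p) y (b l) • fderiv ℝ u y (b l) := fun l ↦
      (hW₁ l l).of_le (by exact_mod_cast le_top)
    calc sobolevEnergy i (fun y ↦ ∑ l, fderiv ℝ (P.cut p) y (b l) • fderiv ℝ u y (b l))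
        ≤ (Finset.univ.card : ℝ≥0∞) * ∑ l, sobolevEnergy i
            (fun y ↦ fderiv ℝ (P.cut p) y (b l) • fderiv ℝ u y (b l)) :=
          sobolevEnergy_sum_le_card i Finset.univ fun l _ ↦ hsm l
      _ ≤ (Module.finrank ℝ E' : ℝ≥0∞) * ∑ l, C₁ l l * TOT := by
          rw [Finset.card_univ, Fintype.card_fin]
          exact mul_le_mul' le_rfl (Finset.sum_le_sum fun l _ ↦ hC₁ l l hf)
      _ ≤ (Module.finrank ℝ E' : ℝ≥0∞) * (S₁ * TOT) := by
          refine mul_le_mul' le_rfl ?_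
          rw [hS₁, Finset.sum_mul]
          refine Finset.sum_le_sum fun l _ ↦ ?_
          rw [Finset.sum_mul]
          exact Finset.single_le_sum (f := fun k ↦ C₁ l k * TOT) (fun _ _ ↦ bot_le) (Finset.mem_univ l)
  have bT₈ : sobolevEnergy i (fun y ↦ -T₈ y) ≤ C₃ * TOT := by
    rw [sobolevEnergy_neg' i hT₈s, hT₈]
    exact (hC₃ hf).trans (mul_le_mul' le_rfl hTOT0)
  -- Step 4: assemble
  have hkey : sobolevEnergy i (fun y ↦ -T₁ y) + sobolevEnergy i (fun y ↦ -T₂ y) +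
      sobolevEnergy i (fun y ↦ -T₃ y) + sobolevEnergy i T₄ + sobolevEnergy i T₅ +
      sobolevEnergy i (cutExpr P p g) + sobolevEnergy i (fun y ↦ (-2 : ℝ) • T₇ y) +
      sobolevEnergy i (fun y ↦ -T₈ y) ≤
      (A + B) * ENNReal.ofReal (Mc ^ 2 + 1) * TOT + sobolevEnergy i (cutExpr P p g) := by
    have hM1 : ENNReal.ofReal (Mc ^ 2) ≤ ENNReal.ofReal (Mc ^ 2 + 1) := hMc2
    have h11 : (1 : ℝ≥0∞) ≤ ENNReal.ofReal (Mc ^ 2 + 1) := by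
      rw [← ENNReal.ofReal_one]; exact ENNReal.ofReal_le_ofReal (by nlinarith)
    calc _ ≤ Cdd * ENNReal.ofReal (Mc ^ 2) * (S₁ * TOT) + Cdd * ENNReal.ofReal (Mc ^ 2) * (S₁ * TOT) +
          Cdd * ENNReal.ofReal (Mc ^ 2) * (S₂ * TOT) + (Module.finrank ℝ E' : ℝ≥0∞) * Ccl * ENNReal.ofReal (Mc ^ 2) * (S₁' * TOT) +
          Ccl * ENNReal.ofReal (Mc ^ 2) * (C₀ * TOT) + sobolevEnergy i (cutExpr P p g) +
          4 * ((Module.finrank ℝ E' : ℝ≥0∞) * (S₁ * TOT)) + C₃ * TOT := by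
          gcongr
      _ = (ENNReal.ofReal (Mc ^ 2) * A + 1 * B) * TOT + sobolevEnergy i (cutExpr P p g) := by
          rw [hA, hB]; ring
      _ ≤ (ENNReal.ofReal (Mc ^ 2 + 1) * A + ENNReal.ofReal (Mc ^ 2 + 1) * B) * TOT +
          sobolevEnergy i (cutExpr P p g) := by
          gcongr
      _ = (A + B) * ENNReal.ofReal (Mc ^ 2 + 1) * TOT + sobolevEnergy i (cutExpr P p g) := by ring
  calc 8 * (sobolevEnergy i (fun y ↦ -T₁ y) + sobolevEnergy i (fun y ↦ -T₂ y) +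
        sobolevEnergy i (fun y ↦ -T₃ y) + sobolevEnergy i T₄ + sobolevEnergy i T₅ +
        sobolevEnergy i (cutExpr P p g) + sobolevEnergy i (fun y ↦ (-2 : ℝ) • T₇ y) +
        sobolevEnergy i (fun y ↦ -T₈ y))
      ≤ 8 * ((A + B) * ENNReal.ofReal (Mc ^ 2 + 1) * TOT + sobolevEnergy i (cutExpr P p g)) :=
        mul_le_mul' le_rfl hkey
    _ = 8 * (A + B) * ENNReal.ofReal (Mc ^ 2 + 1) * TOT + 8 * sobolevEnergy i (cutExpr P p g) := by ring

end LowEnergy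

section Top

variable [MeasurableSpace E'] [BorelSpace E'] [I.Boundaryless] [IsManifold I ∞ M] [T2Space M]

/-- **The energy of the heat residual of a cut-off chart expression**: top order with the sharp
constant and the small factor `η²`, lower order through all patches. For `ε ∈ (0, 1]` and every
`i` there are `C_sh, C_low, C_g < ∞` (depending on the patch system, `p`, `i`, `ε` only) such
that for all data as in `sobolevEnergy_low_le`, `sobolevEnergy_top_le`, with `uₜ` smooth on the
target and satisfying the chart form of the system there,
`E_i(cut • uₜ - Δw_p) ≤ (1+ε) n² Σₖₗ [(1+ε)η² E_i(∂ₖ∂ₗw_p) + C_sh Mc² E_i(∂ₗw_p)]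
  + (1+ε⁻¹) [C_low (Mc²+1) Σ_q (E_i(w_q) + Σ_m E_i(∂_m w_q)) + C_g E_i(cutExpr P p g)]`
(`uₜ` enters through the smooth product `cut • uₜ` and its values on the target).
[cite: Evans2010, §7.1.3] -/
theorem sobolevEnergy_residual_le_explicit (p : ι) (i : ℕ) {ε : ℝ} (hε : 0 < ε) (hε1 : ε ≤ 1) :
    ∃ Csh Clow : ℝ≥0∞, Csh ≠ ⊤ ∧ Clow ≠ ⊤ ∧
      ∀ {f g : M → F'} {uₜ : E' → F'} {Ss : E' → (E' →L[ℝ] E')}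
        {𝔟s : E' → ((E' →L[ℝ] F') →L[ℝ] F')} {𝔠s : E' → (F' →L[ℝ] F')} {η Mc : ℝ},
      (∀ q, ContDiffOn ℝ ∞ (f ∘ (P.chart q).inv) (P.chart q).target) →
      ContDiffOn ℝ ∞ (g ∘ (P.chart p).inv) (P.chart p).target →
      (ContDiff ℝ ∞ fun y ↦ P.cut p y • uₜ y) →
      (∀ y ∈ (P.chart p).target, uₜ y = frameOp (Ss y) (𝔟s y) (𝔠s y) (f ∘ (P.chart p).inv) y +
        g ((P.chart p).inv y)) →
      (∀ k l, ContDiff ℝ ∞ (topCoeff P p Ss k l)) → (∀ l, ContDiff ℝ ∞ (firstCoeff P p 𝔟s l)) →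
      ContDiff ℝ ∞ (zeroCoeff P p 𝔠s) →
      (∀ k l y, |topCoeff P p Ss k l y| ≤ η) →
      (∀ k l y, |topCoeff P p Ss k l y| ≤ Mc) →
      (∀ k l, ∀ lst : List (Fin (Module.finrank ℝ E')), lst ≠ [] → lst.length ≤ i →
        ∀ y, ‖iterDirDeriv (lst.map (stdOrthonormalBasis ℝ E')) (topCoeff P p Ss k l) y‖ ≤ Mc) →
      (∀ l y, ‖firstCoeff P p 𝔟s l y‖ ≤ Mc) →
      (∀ l, ∀ lst : List (Fin (Module.finrank ℝ E')), lst ≠ [] → lst.length ≤ i →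
        ∀ y, ‖iterDirDeriv (lst.map (stdOrthonormalBasis ℝ E')) (firstCoeff P p 𝔟s l) y‖ ≤ Mc) →
      (∀ y, ‖zeroCoeff P p 𝔠s y‖ ≤ Mc) →
      (∀ lst : List (Fin (Module.finrank ℝ E')), lst ≠ [] → lst.length ≤ i →
        ∀ y, ‖iterDirDeriv (lst.map (stdOrthonormalBasis ℝ E')) (zeroCoeff P p 𝔠s) y‖ ≤ Mc) →
      sobolevEnergy i (fun y ↦ P.cut p y • uₜ y - (Δ (cutExpr P p f)) y) ≤
        ENNReal.ofReal (1 + ε) * (((Module.finrank ℝ E' * Module.finrank ℝ E' : ℕ) : ℝ≥0∞) * ∑ k, ∑ l,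
          (ENNReal.ofReal (1 + ε) * ENNReal.ofReal (η ^ 2) *
              sobolevEnergy i (fun y ↦ fderiv ℝ (fun z ↦ fderiv ℝ (cutExpr P p f) z
                (stdOrthonormalBasis ℝ E' l)) y (stdOrthonormalBasis ℝ E' k)) +
            Csh * ENNReal.ofReal (Mc ^ 2) *
              sobolevEnergy i (fun y ↦ fderiv ℝ (cutExpr P p f) y (stdOrthonormalBasis ℝ E' l)))) +
        ENNReal.ofReal (1 + ε⁻¹) * (Clow * ENNReal.ofReal (Mc ^ 2 + 1) *
            ∑ q, (sobolevEnergy i (cutExpr P q f) +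
              ∑ m, sobolevEnergy i (fun y ↦ fderiv ℝ (cutExpr P q f) y (stdOrthonormalBasis ℝ E' m))) +
          8 * sobolevEnergy i (cutExpr P p g)) := by
  obtain ⟨Csh, hCshtop, hCsh⟩ := sobolevEnergy_top_le (F' := F') P p i hε hε1
  obtain ⟨Clow, hClowtop, hClow⟩ := sobolevEnergy_low_le_explicit (F' := F') P p i
  refine ⟨Csh, Clow, hCshtop, hClowtop, ?_⟩
  intro f g uₜ Ss 𝔟s 𝔠s η Mc hf hg huₜ hpde ha hBf hCf haη ha0 haw hB0 hBw hC0 hCw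
  set b := stdOrthonormalBasis ℝ E'
  have hV := (P.chart p).isOpen_target
  have hcs : ContDiff ℝ ∞ (P.cut p) := (P.cut p).contDiff
  have hct : tsupport (P.cut p) ⊆ (P.chart p).target := P.tsupport_cut_subset p
  have hw : ContDiff ℝ ∞ (cutExpr P p f) := contDiff_cutExpr P (hf p)
  -- as functions: `RES = TOP + LOW` (the pointwise identity on the target; off it all vanishes)
  obtain ⟨TOP, hTOP⟩ : ∃ TOP : E' → F', TOP = fun y ↦ principalPart (Ss y - 1) (cutExpr P p f) y := ⟨_, rfl⟩
  obtain ⟨LOW, hLOW⟩ : ∃ LOW : E' → F', LOW = fun y ↦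
      -lowerSymbol (Ss y - 1) (P.cut p) (f ∘ (P.chart p).inv) y +
      P.cut p y • (𝔟s y (fderiv ℝ (f ∘ (P.chart p).inv) y) + 𝔠s y ((f ∘ (P.chart p).inv) y) +
        g ((P.chart p).inv y)) -
      (2 • ∑ l, fderiv ℝ (P.cut p) y (b l) • fderiv ℝ (f ∘ (P.chart p).inv) y (b l)) -
      (Δ (⇑(P.cut p))) y • (f ∘ (P.chart p).inv) y := ⟨_, rfl⟩
  have hRES : (fun y ↦ P.cut p y • uₜ y - (Δ (cutExpr P p f)) y) = fun y ↦ TOP y + LOW y := by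
    funext y
    rw [hTOP, hLOW, cutExpr_eq_smul]
    simp only
    have hfun : (fun y ↦ P.cut p y • f ((P.chart p).inv y)) =
        fun z ↦ P.cut p z • (f ∘ (P.chart p).inv) z := rfl
    rw [hfun]
    by_cases hy : y ∈ (P.chart p).target
    · rw [cut_smul_sub_laplacian_smul_eq hV hcs hct (hf p) Ss (𝔟s y) (𝔠s y)
        (fun y ↦ g ((P.chart p).inv y)) (hpde y hy)]
      abel
    · -- off the target: every term vanishes
      have hy' : y ∉ tsupport (P.cut p) := fun h ↦ hy (hct h)
      obtain ⟨h0, h1⟩ := eq_zero_of_notMem_tsupport (P.cut p) hy'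
      have hP : principalPart (Ss y - 1) (fun z ↦ P.cut p z • (f ∘ (P.chart p).inv) z) y = 0 := by
        rw [← hfun, ← cutExpr_eq_smul, principalPart_sub_one_eq_sum_topCoeff]
        refine Finset.sum_eq_zero fun k _ ↦ Finset.sum_eq_zero fun l _ ↦ ?_
        rw [fderiv_fderiv_cutExpr_eq_zero P p f hy']
        simp
      have hΔw : (Δ (fun z ↦ P.cut p z • (f ∘ (P.chart p).inv) z)) y = 0 := by
        have hev : (fun z ↦ P.cut p z • f ((P.chart p).inv z)) =ᶠ[𝓝 y] fun _ ↦ 0 := by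
          have hc : (P.cut p : E' → ℝ) =ᶠ[𝓝 y] fun _ ↦ 0 := notMem_tsupport_iff_eventuallyEq.1 hy'
          filter_upwards [hc] with z hz
          simp [hz]
        have h2 : iteratedFDeriv ℝ 2 (fun z ↦ P.cut p z • f ((P.chart p).inv z)) y = 0 := by
          rw [(hev.iteratedFDeriv ℝ 2).self_of_nhds, iteratedFDeriv_const_of_ne two_ne_zero]
          rfl
        show (Δ (fun z ↦ P.cut p z • f ((P.chart p).inv z))) y = 0
        rw [laplacian_eq_iteratedFDeriv_stdOrthonormalBasis]
        simp [h2]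
      rw [hP, hΔw, lowerSymbol_eq_zero _ _ hy', h0, h1, laplacian_cut_eq_zero P p hy']
      simp
  -- smoothness of `RES` and `TOP`, hence of `LOW`
  have hRESs : ContDiff ℝ ∞ fun y ↦ P.cut p y • uₜ y - (Δ (cutExpr P p f)) y :=
    huₜ.sub (contDiff_laplacian_of_contDiff hw)
  have hTOPs : ContDiff ℝ ∞ TOP := by
    rw [hTOP]
    have heq : (fun y ↦ principalPart (Ss y - 1) (cutExpr P p f) y) = fun y ↦ ∑ k, ∑ l,
        topCoeff P p Ss k l y • fderiv ℝ (fun z ↦ fderiv ℝ (cutExpr P p f) z (b l)) y (b k) :=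
      funext fun y ↦ principalPart_sub_one_eq_sum_topCoeff P p Ss f y
    rw [heq]
    have hd1 : ∀ v, ContDiff ℝ ∞ fun y ↦ fderiv ℝ (cutExpr P p f) y v := fun v ↦
      (hw.fderiv_right (m := ∞) (by norm_cast)).clm_apply contDiff_const
    exact ContDiff.sum fun k _ ↦ ContDiff.sum fun l _ ↦ (ha k l).smul
      (((hd1 (b l)).fderiv_right (m := ∞) (by norm_cast)).clm_apply contDiff_const)
  have hLOWs : ContDiff ℝ ∞ LOW := by
    have h : LOW = fun y ↦ (P.cut p y • uₜ y - (Δ (cutExpr P p f)) y) - TOP y := by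
      funext y
      have hy : P.cut p y • uₜ y - (Δ (cutExpr P p f)) y = TOP y + LOW y := congr_fun hRES y
      rw [hy]
      abel
    rw [h]
    exact hRESs.sub hTOPs
  -- combine
  rw [hRES]
  refine (sobolevEnergy_add_le_eps i (hTOPs.of_le (by exact_mod_cast le_top))
    (hLOWs.of_le (by exact_mod_cast le_top)) hε).trans ?_
  refine add_le_add (mul_le_mul' le_rfl ?_) (mul_le_mul' le_rfl ?_)
  · rw [hTOP]
    exact hCsh (hf p) ha haη haw
  · rw [hLOW]
    exact hClow hf hg ha hBf hCf ha0 haw hB0 hBw hC0 hCw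

end Top

section PerTime

variable [IsManifold I ∞ M] [I.Boundaryless] [T2Space M] [MeasurableSpace E'] [BorelSpace E'] {T : ℝ}

/-- **Per-time energy inequality for the residual of a patch, uniform in sub-slabs** (coefficient
fields fixed on `[0, T]`, `ε = 1`): there are finite `A₂, A₃, A₄` such that for every `T' ≤ T`, every
`v`, `g` with slab-smooth chart expressions on `[0, T']` satisfying the chart form of the system in
the patch `p`, and every `s ∈ [0, T']`,
`E_i(∂ₜw_p - Δw_p) ≤ 4n²η² Σₖₗ E_i(∂ₖ∂ₗw_p) + A₂ Σₗ E_i(∂ₗw_p)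
  + A₃ Σ_q (E_i(w_q) + Σ_m E_i(∂_m w_q)) + A₄ E_i(cutExpr P p (g s))` (all at time `s`).
[cite: Evans2010, §7.1.3] -/
theorem sobolevEnergy_slabResidual_le_explicit (hT : 0 < T) (p : ι) (i : ℕ) {S : ℝ → E' → (E' →L[ℝ] E')}
    {𝔟 : ℝ → E' → ((E' →L[ℝ] F') →L[ℝ] F')} {𝔠 : ℝ → E' → (F' →L[ℝ] F')}
    (hS : ContDiffOn ℝ ∞ (uncurry S) (Icc 0 T ×ˢ (P.chart p).target))
    (h𝔟 : ContDiffOn ℝ ∞ (uncurry 𝔟) (Icc 0 T ×ˢ (P.chart p).target))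
    (h𝔠 : ContDiffOn ℝ ∞ (uncurry 𝔠) (Icc 0 T ×ˢ (P.chart p).target)) {η : ℝ} (hη : 0 ≤ η)
    (hηS : ∀ s ∈ Icc 0 T, ∀ y ∈ closedBall (0 : E') (4 * P.r p), ‖S s y - 1‖ ≤ η) :
    ∃ A₂ A₃ : ℝ≥0∞, A₂ ≠ ⊤ ∧ A₃ ≠ ⊤ ∧ ∀ {T' : ℝ}, 0 < T' → T' ≤ T → ∀ {v g : ℝ → M → F'},
      (∀ q, ContDiffOn ℝ ∞ (uncurry fun s y ↦ v s ((P.chart q).inv y)) (Icc 0 T' ×ˢ (P.chart q).target)) →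
      ContDiffOn ℝ ∞ (uncurry fun s y ↦ g s ((P.chart p).inv y)) (Icc 0 T' ×ˢ (P.chart p).target) →
      (∀ s ∈ Icc 0 T', ∀ y ∈ (P.chart p).target,
        timeDerivWithin (Icc 0 T') (fun s y ↦ v s ((P.chart p).inv y)) s y =
          frameOp (S s y) (𝔟 s y) (𝔠 s y) (fun y ↦ v s ((P.chart p).inv y)) y + g s ((P.chart p).inv y)) →
      ∀ s ∈ Icc 0 T',
        sobolevEnergy i (slabResidual 1 T' (fun s ↦ cutExpr P p (v s)) s) ≤
          ENNReal.ofReal (4 * (Module.finrank ℝ E' : ℝ) ^ 2 * η ^ 2) * ∑ k, ∑ l,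
              sobolevEnergy i (fun y ↦ fderiv ℝ (fun z ↦ fderiv ℝ (cutExpr P p (v s)) z
                (stdOrthonormalBasis ℝ E' l)) y (stdOrthonormalBasis ℝ E' k)) +
          A₂ * ∑ l, sobolevEnergy i (fun y ↦ fderiv ℝ (cutExpr P p (v s)) y (stdOrthonormalBasis ℝ E' l)) +
          A₃ * ∑ q, (sobolevEnergy i (cutExpr P q (v s)) +
            ∑ m, sobolevEnergy i (fun y ↦ fderiv ℝ (cutExpr P q (v s)) y (stdOrthonormalBasis ℝ E' m))) +
          16 * sobolevEnergy i (cutExpr P p (g s)) := by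
  classical
  obtain ⟨Csh, Clow, hCshtop, hClowtop, hres⟩ :=
    sobolevEnergy_residual_le_explicit (F' := F') P p i one_pos le_rfl
  obtain ⟨Mc, hMc0, hMc⟩ := exists_coeff_bound (F' := F') P hT p i hS h𝔟 h𝔠
  set N2 : ℝ≥0∞ := ((Module.finrank ℝ E' * Module.finrank ℝ E' : ℕ) : ℝ≥0∞) with hN2
  refine ⟨2 * N2 * (Module.finrank ℝ E' : ℝ≥0∞) * Csh * ENNReal.ofReal (Mc ^ 2),
    2 * Clow * ENNReal.ofReal (Mc ^ 2 + 1), ?_, ?_, ?_⟩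
  · exact ENNReal.mul_ne_top (ENNReal.mul_ne_top (ENNReal.mul_ne_top (ENNReal.mul_ne_top (by norm_num)
      (ENNReal.natCast_ne_top _)) (ENNReal.natCast_ne_top _)) hCshtop) ENNReal.ofReal_ne_top
  · exact ENNReal.mul_ne_top (ENNReal.mul_ne_top (by norm_num) hClowtop) ENNReal.ofReal_ne_top
  intro T' hT' hT'T v g hv hg hpde s hs
  have hsT : s ∈ Icc 0 T := ⟨hs.1, hs.2.trans hT'T⟩
  -- the slice data
  have hslice : ∀ {G : ℝ → E' → F'} {V : Set E'}, ContDiffOn ℝ ∞ (uncurry G) (Icc 0 T' ×ˢ V) →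
      ContDiffOn ℝ ∞ (G s) V := fun {G V} hG ↦
    hG.comp (contDiff_const.prodMk contDiff_id).contDiffOn fun y hy ↦ mk_mem_prod hs hy
  have hf : ∀ q, ContDiffOn ℝ ∞ (v s ∘ (P.chart q).inv) (P.chart q).target := fun q ↦ hslice (hv q)
  have hg' : ContDiffOn ℝ ∞ (g s ∘ (P.chart p).inv) (P.chart p).target := hslice hg
  have hcu := contDiff_timeDerivWithin_cutExpr P hT' p (hv p) hs
  have ha : ∀ k l, ContDiff ℝ ∞ (topCoeff P p (S s) k l) := fun k l ↦
    (isSmoothSpaceTimeOn_topCoeff P p hS k l).contDiff_slice hsT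
  have hBf : ∀ l, ContDiff ℝ ∞ (firstCoeff P p (𝔟 s) l) := fun l ↦
    (isSmoothSpaceTimeOn_firstCoeff P p h𝔟 l).contDiff_slice hsT
  have hCf : ContDiff ℝ ∞ (zeroCoeff P p (𝔠 s)) := (isSmoothSpaceTimeOn_zeroCoeff P p h𝔠).contDiff_slice hsT
  have haη : ∀ k l y, |topCoeff P p (S s) k l y| ≤ η := abs_topCoeff_le P p hη (hηS s hsT)
  obtain ⟨ha0, haw, hB0, hBw, hC0, hCw⟩ := hMc s hsT
  have h := hres hf hg' hcu (fun y hy ↦ hpde s hs y hy) ha hBf hCf haη ha0 haw hB0 hBw hC0 hCw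
  rw [slabResidual_cutExpr_eq P p (hv p) hs]
  refine h.trans (le_of_eq ?_)
  -- arithmetic with `ε = 1`
  have h2 : ENNReal.ofReal (1 + 1) = 2 := by norm_num
  have h2' : ENNReal.ofReal (1 + 1⁻¹) = 2 := by norm_num
  rw [h2, h2']
  have key : ∀ (A B : ℝ≥0∞) (a : Fin (Module.finrank ℝ E') → Fin (Module.finrank ℝ E') → ℝ≥0∞)
      (c : Fin (Module.finrank ℝ E') → ℝ≥0∞),
      ∑ k, ∑ l, (A * a k l + B * c l) = A * ∑ k, ∑ l, a k l + (Module.finrank ℝ E' : ℝ≥0∞) * B * ∑ l, c l := by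
    intro A B a c
    simp only [Finset.sum_add_distrib, Finset.mul_sum]
    congr 1
    simp only [Finset.sum_const, Finset.card_univ, Fintype.card_fin, nsmul_eq_mul]
    rw [Finset.mul_sum]
    refine Finset.sum_congr rfl fun l _ ↦ ?_
    ring
  rw [key]
  have hη2 : ENNReal.ofReal (4 * (Module.finrank ℝ E' : ℝ) ^ 2 * η ^ 2) =
      2 * N2 * (2 * ENNReal.ofReal (η ^ 2)) := by
    rw [hN2, show (4 * (Module.finrank ℝ E' : ℝ) ^ 2 * η ^ 2) = (2 * ((Module.finrank ℝ E' *
      Module.finrank ℝ E' : ℕ) : ℝ)) * (2 * η ^ 2) by push_cast; ring]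
    rw [ENNReal.ofReal_mul (by positivity), ENNReal.ofReal_mul (by norm_num),
      ENNReal.ofReal_mul (by norm_num), ENNReal.ofReal_natCast]
    norm_num
  rw [hη2]
  ring

end PerTime

section Main

variable [IsManifold I ∞ M] [I.Boundaryless] [T2Space M] [MeasurableSpace E'] [BorelSpace E']
  [FiniteDimensional ℝ F'] {T : ℝ}

/-- **The linear a priori estimate on a closed manifold (residual form), with constants serving every
sub-slab `[0, T']`, `T' ≤ T`.** Given a patch system,
slab-smooth coefficient fields with symbol within `η` of the identity on each patch,
`16 n³ η² ≤ 1`, and an order `i`, there are `Λ > 0` and `C < ∞` such that for every `λ ≥ Λ`,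
every `v` (with `v(0) = 0`) and `g` with slab-smooth chart expressions satisfying the chart form
of the linear system `∂ₜv̂_p = frameOp (S p) (𝔟 p) (𝔠 p) v̂_p + ĝ_p` on every patch, and every
`t ∈ [0, T]`:
`Σ_p ∫₀ᵗ e^{-2λs} E_i(∂ₜw_p - Δw_p) ≤ C Σ_p ∫₀ᵗ e^{-2λs} E_i(cutExpr P p (g s))`,
`w_p = cutExpr P p (v ·)`. [cite: Evans2010, §7.1.3] -/
theorem linear_apriori_residual_le_explicit (hT : 0 < T) (i : ℕ) {S : ι → ℝ → E' → (E' →L[ℝ] E')}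
    {𝔟 : ι → ℝ → E' → ((E' →L[ℝ] F') →L[ℝ] F')} {𝔠 : ι → ℝ → E' → (F' →L[ℝ] F')}
    (hS : ∀ p, ContDiffOn ℝ ∞ (uncurry (S p)) (Icc 0 T ×ˢ (P.chart p).target))
    (h𝔟 : ∀ p, ContDiffOn ℝ ∞ (uncurry (𝔟 p)) (Icc 0 T ×ˢ (P.chart p).target))
    (h𝔠 : ∀ p, ContDiffOn ℝ ∞ (uncurry (𝔠 p)) (Icc 0 T ×ˢ (P.chart p).target)) {η : ℝ} (hη : 0 ≤ η)
    (hηS : ∀ p, ∀ s ∈ Icc 0 T, ∀ y ∈ closedBall (0 : E') (4 * P.r p), ‖S p s y - 1‖ ≤ η)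
    (hsmall : 16 * (Module.finrank ℝ E' : ℝ) ^ 3 * η ^ 2 ≤ 1) :
    ∃ Λ : ℝ, 0 < Λ ∧ ∀ {lam : ℝ}, Λ ≤ lam → ∀ {T' : ℝ}, 0 < T' → T' ≤ T → ∀ {v g : ℝ → M → F'},
      (∀ p, ContDiffOn ℝ ∞ (uncurry fun s y ↦ v s ((P.chart p).inv y)) (Icc 0 T' ×ˢ (P.chart p).target)) →
      (∀ x, v 0 x = 0) →
      (∀ p, ContDiffOn ℝ ∞ (uncurry fun s y ↦ g s ((P.chart p).inv y)) (Icc 0 T' ×ˢ (P.chart p).target)) →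
      (∀ p, ∀ s ∈ Icc 0 T', ∀ y ∈ (P.chart p).target,
        timeDerivWithin (Icc 0 T') (fun s y ↦ v s ((P.chart p).inv y)) s y =
          frameOp (S p s y) (𝔟 p s y) (𝔠 p s y) (fun y ↦ v s ((P.chart p).inv y)) y +
            g s ((P.chart p).inv y)) →
      ∀ t ∈ Icc 0 T',
        ∑ p, ∫⁻ s in Ioo 0 t, ENNReal.ofReal (Real.exp (-2 * lam * s)) *
            sobolevEnergy i (slabResidual 1 T' (fun s ↦ cutExpr P p (v s)) s) ≤
          (32 * (Fintype.card ι : ℝ≥0∞)) * ∑ p, ∫⁻ s in Ioo 0 t, ENNReal.ofReal (Real.exp (-2 * lam * s)) *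
            sobolevEnergy i (cutExpr P p (g s)) := by
  classical
  -- per-patch constants of the per-time inequality
  have hp : ∀ p, ∃ A₂ A₃ : ℝ≥0∞, A₂ ≠ ⊤ ∧ A₃ ≠ ⊤ ∧ ∀ {T' : ℝ}, 0 < T' → T' ≤ T → ∀ {v g : ℝ → M → F'},
      (∀ q, ContDiffOn ℝ ∞ (uncurry fun s y ↦ v s ((P.chart q).inv y)) (Icc 0 T' ×ˢ (P.chart q).target)) →
      ContDiffOn ℝ ∞ (uncurry fun s y ↦ g s ((P.chart p).inv y)) (Icc 0 T' ×ˢ (P.chart p).target) →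
      (∀ s ∈ Icc 0 T', ∀ y ∈ (P.chart p).target,
        timeDerivWithin (Icc 0 T') (fun s y ↦ v s ((P.chart p).inv y)) s y =
          frameOp (S p s y) (𝔟 p s y) (𝔠 p s y) (fun y ↦ v s ((P.chart p).inv y)) y + g s ((P.chart p).inv y)) →
      ∀ s ∈ Icc 0 T',
        sobolevEnergy i (slabResidual 1 T' (fun s ↦ cutExpr P p (v s)) s) ≤
          ENNReal.ofReal (4 * (Module.finrank ℝ E' : ℝ) ^ 2 * η ^ 2) * ∑ k, ∑ l,
              sobolevEnergy i (fun y ↦ fderiv ℝ (fun z ↦ fderiv ℝ (cutExpr P p (v s)) z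
                (stdOrthonormalBasis ℝ E' l)) y (stdOrthonormalBasis ℝ E' k)) +
          A₂ * ∑ l, sobolevEnergy i (fun y ↦ fderiv ℝ (cutExpr P p (v s)) y (stdOrthonormalBasis ℝ E' l)) +
          A₃ * ∑ q, (sobolevEnergy i (cutExpr P q (v s)) +
            ∑ m, sobolevEnergy i (fun y ↦ fderiv ℝ (cutExpr P q (v s)) y (stdOrthonormalBasis ℝ E' m))) +
          16 * sobolevEnergy i (cutExpr P p (g s)) := fun p ↦
    sobolevEnergy_slabResidual_le_explicit P hT p i (hS p) (h𝔟 p) (h𝔠 p) hη (hηS p)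
  choose A₂ A₃ hA₂ hA₃ hineq using hp
  set A₄ : ι → ℝ≥0∞ := fun _ ↦ 16 with hA₄def
  have hA₄ : ∀ p, A₄ p ≠ ⊤ := fun _ ↦ by norm_num
  set a₂ : ℝ≥0∞ := ∑ p, A₂ p with ha₂
  set a₃ : ℝ≥0∞ := ∑ p, A₃ p with ha₃
  set a₄ : ℝ≥0∞ := ∑ p, A₄ p with ha₄
  have ha₂top : a₂ ≠ ⊤ := ENNReal.sum_ne_top.2 fun p _ ↦ hA₂ p
  have ha₃top : a₃ ≠ ⊤ := ENNReal.sum_ne_top.2 fun p _ ↦ hA₃ p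
  have ha₄top : a₄ ≠ ⊤ := ENNReal.sum_ne_top.2 fun p _ ↦ hA₄ p
  have hA₂le : ∀ p, A₂ p ≤ a₂ := fun p ↦ Finset.single_le_sum (f := A₂) (fun _ _ ↦ bot_le) (Finset.mem_univ p)
  have hA₄le : ∀ p, A₄ p ≤ a₄ := fun p ↦ Finset.single_le_sum (f := A₄) (fun _ _ ↦ bot_le) (Finset.mem_univ p)
  -- the threshold `Λ`
  set Kc : ℝ≥0∞ := a₂ + 2 * a₃ with hKc
  have hKctop : Kc ≠ ⊤ := ENNReal.add_ne_top.2 ⟨ha₂top, ENNReal.mul_ne_top (by norm_num) ha₃top⟩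
  refine ⟨max 1 (4 * Kc.toReal), lt_max_of_lt_left one_pos, ?_⟩
  have hCeq : (32 * (Fintype.card ι : ℝ≥0∞)) = 2 * a₄ := by
    simp only [ha₄, hA₄def, Finset.sum_const, Finset.card_univ, nsmul_eq_mul]; ring
  rw [hCeq]
  intro lam hlam T' hT' hT'T v g hv hv0 hg hpde t ht
  have hlam1 : 1 ≤ lam := (le_max_left _ _).trans hlam
  have hlam0 : 0 < lam := one_pos.trans_le hlam1
  have hlamK : 4 * Kc.toReal ≤ lam := (le_max_right _ _).trans hlam
  -- notation for the weighted integrals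
  set W : ℝ → ℝ≥0∞ := fun s ↦ ENNReal.ofReal (Real.exp (-2 * lam * s)) with hW
  have hWm : Measurable W := (Real.continuous_exp.comp (continuous_const.mul continuous_id)).measurable.ennreal_ofReal
  set w : ι → ℝ → E' → F' := fun p s ↦ cutExpr P p (v s) with hw
  -- the families `w p` satisfy the hypotheses of the engine
  have hws : ∀ p, IsSmoothSpaceTimeOn (Icc 0 T') (w p) := fun p ↦ isSmoothSpaceTimeOn_cutExpr P p (hv p)
  have hKp : ∀ p, IsCompact (closedBall (0 : E') (3 * P.r p)) := fun p ↦ isCompact_closedBall _ _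
  have hwK : ∀ p s, ∀ y ∉ closedBall (0 : E') (3 * P.r p), w p s y = 0 := fun p s y hy ↦
    cutExpr_family_eq_zero P p s hy
  have hw0 : ∀ p y, w p 0 y = 0 := fun p y ↦ cutExpr_family_zero P p hv0 y
  -- the quantities
  set R : ι → ℝ≥0∞ := fun p ↦ ∫⁻ s in Ioo 0 t, W s * sobolevEnergy i (slabResidual 1 T' (w p) s) with hR
  set X : ι → ℝ≥0∞ := fun p ↦ ∫⁻ s in Ioo 0 t, W s * ∑ k, ∑ l, sobolevEnergy i
    (fun y ↦ fderiv ℝ (fun z ↦ fderiv ℝ (w p s) z (stdOrthonormalBasis ℝ E' l)) y (stdOrthonormalBasis ℝ E' k))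
    with hX
  set Y : ι → ℝ≥0∞ := fun p ↦ ∫⁻ s in Ioo 0 t, W s * ∑ l, sobolevEnergy i
    (fun y ↦ fderiv ℝ (w p s) y (stdOrthonormalBasis ℝ E' l)) with hY
  set Z : ι → ℝ≥0∞ := fun p ↦ ∫⁻ s in Ioo 0 t, W s * sobolevEnergy i (w p s) with hZ
  set G : ι → ℝ≥0∞ := fun p ↦ ∫⁻ s in Ioo 0 t, W s * sobolevEnergy i (cutExpr P p (g s)) with hG
  -- the engine bounds
  have hXle : ∀ p, X p ≤ (Module.finrank ℝ E' : ℝ≥0∞) * R p := by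
    intro p
    have h := lintegral_weight_sum_sobolevEnergy_fderiv_fderiv_le_residual hT' one_pos (hws p) (hKp p) (hwK p)
      (hw0 p) hlam0.le i ht
    have h1 : ENNReal.ofReal ((Module.finrank ℝ E' : ℝ) / 1 ^ 2) = (Module.finrank ℝ E' : ℝ≥0∞) := by
      rw [one_pow, div_one, ENNReal.ofReal_natCast]
    rw [h1] at h
    refine le_trans (le_of_eq ?_) h
    rw [hX]
    simp only
    refine lintegral_congr fun s ↦ ?_
    rw [Finset.sum_comm]
  have hYle : ∀ p, Y p ≤ ENNReal.ofReal (lam⁻¹ / 2) * R p := by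
    intro p
    have h := lintegral_weight_sum_sobolevEnergy_fderiv_le_residual hT' one_pos (hws p) (hKp p) (hwK p)
      (hw0 p) hlam0 i ht
    rwa [mul_one] at h
  have hZle : ∀ p, Z p ≤ ENNReal.ofReal (lam⁻¹ ^ 2) * R p := fun p ↦
    lintegral_weight_sobolevEnergy_le_residual hT' one_pos (hws p) (hKp p) (hwK p) (hw0 p) hlam0 i ht
  have hRtop : ∀ p, R p ≠ ⊤ := fun p ↦
    lintegral_weight_sobolevEnergy_slab_ne_top hT' (isSmoothSpaceTimeOn_slabResidual hT' (hws p)) (hKp p)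
      (fun s y hy ↦ slabResidual_eq_zero (hKp p).isClosed (hwK p) s hy) i hlam0.le ht.2
  -- measurability of the slice energies on `(0, t)`
  have hd1 : ∀ p l, IsSmoothSpaceTimeOn (Icc 0 T') fun s y ↦ fderiv ℝ (w p s) y (stdOrthonormalBasis ℝ E' l) :=
    fun p l ↦ isSmoothSpaceTimeOn_fderiv_apply_Icc hT' (hws p) _
  have hd2 : ∀ p k l, IsSmoothSpaceTimeOn (Icc 0 T') fun s y ↦
      fderiv ℝ (fun z ↦ fderiv ℝ (w p s) z (stdOrthonormalBasis ℝ E' l)) y (stdOrthonormalBasis ℝ E' k) :=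
    fun p k l ↦ isSmoothSpaceTimeOn_fderiv_apply_Icc hT' (hd1 p l) _
  have mX : ∀ p, AEMeasurable (fun s ↦ ∑ k, ∑ l, sobolevEnergy i (fun y ↦ fderiv ℝ
      (fun z ↦ fderiv ℝ (w p s) z (stdOrthonormalBasis ℝ E' l)) y (stdOrthonormalBasis ℝ E' k)))
      (volume.restrict (Ioo 0 t)) := fun p ↦
    Finset.aemeasurable_fun_sum _ fun k _ ↦ Finset.aemeasurable_fun_sum _ fun l _ ↦
      aemeasurable_sobolevEnergy_slice isOpen_Ioo i ((hd2 p k l).mono fun _ hs ↦ ⟨hs.1.le, hs.2.le.trans ht.2⟩)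
  have mY : ∀ p, AEMeasurable (fun s ↦ ∑ l, sobolevEnergy i (fun y ↦ fderiv ℝ (w p s) y
      (stdOrthonormalBasis ℝ E' l))) (volume.restrict (Ioo 0 t)) := fun p ↦
    Finset.aemeasurable_fun_sum _ fun l _ ↦ aemeasurable_sobolevEnergy_slice isOpen_Ioo i ((hd1 p l).mono fun _ hs ↦ ⟨hs.1.le, hs.2.le.trans ht.2⟩)
  have mZ : ∀ p, AEMeasurable (fun s ↦ sobolevEnergy i (w p s)) (volume.restrict (Ioo 0 t)) := fun p ↦
    aemeasurable_sobolevEnergy_slice isOpen_Ioo i ((hws p).mono fun _ hs ↦ ⟨hs.1.le, hs.2.le.trans ht.2⟩)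
  have mG : ∀ p, AEMeasurable (fun s ↦ sobolevEnergy i (cutExpr P p (g s))) (volume.restrict (Ioo 0 t)) :=
    fun p ↦ aemeasurable_sobolevEnergy_slice isOpen_Ioo i ((isSmoothSpaceTimeOn_cutExpr P p (hg p)).mono fun _ hs ↦ ⟨hs.1.le, hs.2.le.trans ht.2⟩)
  have hWm' : AEMeasurable W (volume.restrict (Ioo 0 t)) := hWm.aemeasurable
  -- Step 1: integrate the per-time inequality
  set c₁ : ℝ≥0∞ := ENNReal.ofReal (4 * (Module.finrank ℝ E' : ℝ) ^ 2 * η ^ 2) with hc₁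
  have hRle : ∀ p, R p ≤ c₁ * X p + A₂ p * Y p + A₃ p * ∑ q, (Z q + Y q) + A₄ p * G p := by
    intro p
    have hpt : ∀ s ∈ Ioo 0 t, W s * sobolevEnergy i (slabResidual 1 T' (w p) s) ≤
        W s * (c₁ * ∑ k, ∑ l, sobolevEnergy i (fun y ↦ fderiv ℝ
          (fun z ↦ fderiv ℝ (w p s) z (stdOrthonormalBasis ℝ E' l)) y (stdOrthonormalBasis ℝ E' k))) +
        W s * (A₂ p * ∑ l, sobolevEnergy i (fun y ↦ fderiv ℝ (w p s) y (stdOrthonormalBasis ℝ E' l))) +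
        W s * (A₃ p * ∑ q, (sobolevEnergy i (w q s) +
          ∑ m, sobolevEnergy i (fun y ↦ fderiv ℝ (w q s) y (stdOrthonormalBasis ℝ E' m)))) +
        W s * (A₄ p * sobolevEnergy i (cutExpr P p (g s))) := by
      intro s hs
      have hs' : s ∈ Icc 0 T' := ⟨hs.1.le, hs.2.le.trans ht.2⟩
      have h := hineq p hT' hT'T hv (hg p) (hpde p) s hs'
      calc W s * sobolevEnergy i (slabResidual 1 T' (w p) s)
          ≤ W s * (c₁ * ∑ k, ∑ l, sobolevEnergy i (fun y ↦ fderiv ℝ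
              (fun z ↦ fderiv ℝ (w p s) z (stdOrthonormalBasis ℝ E' l)) y (stdOrthonormalBasis ℝ E' k)) +
            A₂ p * ∑ l, sobolevEnergy i (fun y ↦ fderiv ℝ (w p s) y (stdOrthonormalBasis ℝ E' l)) +
            A₃ p * ∑ q, (sobolevEnergy i (w q s) +
              ∑ m, sobolevEnergy i (fun y ↦ fderiv ℝ (w q s) y (stdOrthonormalBasis ℝ E' m))) +
            A₄ p * sobolevEnergy i (cutExpr P p (g s))) := mul_le_mul' le_rfl h
        _ = _ := by ring
    calc R p ≤ ∫⁻ s in Ioo 0 t, (W s * (c₁ * ∑ k, ∑ l, sobolevEnergy i (fun y ↦ fderiv ℝ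
          (fun z ↦ fderiv ℝ (w p s) z (stdOrthonormalBasis ℝ E' l)) y (stdOrthonormalBasis ℝ E' k))) +
        W s * (A₂ p * ∑ l, sobolevEnergy i (fun y ↦ fderiv ℝ (w p s) y (stdOrthonormalBasis ℝ E' l))) +
        W s * (A₃ p * ∑ q, (sobolevEnergy i (w q s) +
          ∑ m, sobolevEnergy i (fun y ↦ fderiv ℝ (w q s) y (stdOrthonormalBasis ℝ E' m)))) +
        W s * (A₄ p * sobolevEnergy i (cutExpr P p (g s)))) := setLIntegral_mono' measurableSet_Ioo hpt
      _ = c₁ * X p + A₂ p * Y p + A₃ p * ∑ q, (Z q + Y q) + A₄ p * G p := by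
        have m1 : AEMeasurable (fun s ↦ W s * (c₁ * ∑ k, ∑ l, sobolevEnergy i (fun y ↦ fderiv ℝ
            (fun z ↦ fderiv ℝ (w p s) z (stdOrthonormalBasis ℝ E' l)) y (stdOrthonormalBasis ℝ E' k))))
            (volume.restrict (Ioo 0 t)) := hWm'.mul ((mX p).const_mul _)
        have m2 : AEMeasurable (fun s ↦ W s * (A₂ p * ∑ l, sobolevEnergy i (fun y ↦ fderiv ℝ (w p s) y
            (stdOrthonormalBasis ℝ E' l)))) (volume.restrict (Ioo 0 t)) := hWm'.mul ((mY p).const_mul _)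
        have mq : AEMeasurable (fun s ↦ ∑ q, (sobolevEnergy i (w q s) +
            ∑ m, sobolevEnergy i (fun y ↦ fderiv ℝ (w q s) y (stdOrthonormalBasis ℝ E' m))))
            (volume.restrict (Ioo 0 t)) :=
          Finset.aemeasurable_fun_sum _ fun q _ ↦ (mZ q).add (mY q)
        have m3 : AEMeasurable (fun s ↦ W s * (A₃ p * ∑ q, (sobolevEnergy i (w q s) +
            ∑ m, sobolevEnergy i (fun y ↦ fderiv ℝ (w q s) y (stdOrthonormalBasis ℝ E' m)))))
            (volume.restrict (Ioo 0 t)) := hWm'.mul (mq.const_mul _)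
        have m12 : AEMeasurable (fun s ↦ W s * (c₁ * ∑ k, ∑ l, sobolevEnergy i (fun y ↦ fderiv ℝ
            (fun z ↦ fderiv ℝ (w p s) z (stdOrthonormalBasis ℝ E' l)) y (stdOrthonormalBasis ℝ E' k))) +
            W s * (A₂ p * ∑ l, sobolevEnergy i (fun y ↦ fderiv ℝ (w p s) y (stdOrthonormalBasis ℝ E' l))))
            (volume.restrict (Ioo 0 t)) := m1.add m2
        have m123 : AEMeasurable (fun s ↦ W s * (c₁ * ∑ k, ∑ l, sobolevEnergy i (fun y ↦ fderiv ℝ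
            (fun z ↦ fderiv ℝ (w p s) z (stdOrthonormalBasis ℝ E' l)) y (stdOrthonormalBasis ℝ E' k))) +
            W s * (A₂ p * ∑ l, sobolevEnergy i (fun y ↦ fderiv ℝ (w p s) y (stdOrthonormalBasis ℝ E' l))) +
            W s * (A₃ p * ∑ q, (sobolevEnergy i (w q s) +
              ∑ m, sobolevEnergy i (fun y ↦ fderiv ℝ (w q s) y (stdOrthonormalBasis ℝ E' m)))))
            (volume.restrict (Ioo 0 t)) := m12.add m3
        rw [lintegral_add_left' m123, lintegral_add_left' m12, lintegral_add_left' m1]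
        -- each piece (measurability facts in lambda form)
        have mWX : AEMeasurable (fun s ↦ W s * ∑ k, ∑ l, sobolevEnergy i (fun y ↦ fderiv ℝ
            (fun z ↦ fderiv ℝ (w p s) z (stdOrthonormalBasis ℝ E' l)) y (stdOrthonormalBasis ℝ E' k)))
            (volume.restrict (Ioo 0 t)) := hWm'.mul (mX p)
        have mWY : ∀ q, AEMeasurable (fun s ↦ W s * ∑ l, sobolevEnergy i (fun y ↦ fderiv ℝ (w q s) y
            (stdOrthonormalBasis ℝ E' l))) (volume.restrict (Ioo 0 t)) := fun q ↦ hWm'.mul (mY q)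
        have mWZ : ∀ q, AEMeasurable (fun s ↦ W s * sobolevEnergy i (w q s)) (volume.restrict (Ioo 0 t)) :=
          fun q ↦ hWm'.mul (mZ q)
        have mWG : AEMeasurable (fun s ↦ W s * sobolevEnergy i (cutExpr P p (g s))) (volume.restrict (Ioo 0 t)) :=
          hWm'.mul (mG p)
        have e1 : ∫⁻ s in Ioo 0 t, W s * (c₁ * ∑ k, ∑ l, sobolevEnergy i (fun y ↦ fderiv ℝ
            (fun z ↦ fderiv ℝ (w p s) z (stdOrthonormalBasis ℝ E' l)) y (stdOrthonormalBasis ℝ E' k))) =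
            c₁ * X p := by
          calc _ = ∫⁻ s in Ioo 0 t, c₁ * (W s * ∑ k, ∑ l, sobolevEnergy i (fun y ↦ fderiv ℝ
                (fun z ↦ fderiv ℝ (w p s) z (stdOrthonormalBasis ℝ E' l)) y (stdOrthonormalBasis ℝ E' k))) :=
                lintegral_congr fun s ↦ by ring
            _ = c₁ * X p := lintegral_const_mul'' c₁ mWX
        have e2 : ∫⁻ s in Ioo 0 t, W s * (A₂ p * ∑ l, sobolevEnergy i (fun y ↦ fderiv ℝ (w p s) y
            (stdOrthonormalBasis ℝ E' l))) = A₂ p * Y p := by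
          calc _ = ∫⁻ s in Ioo 0 t, A₂ p * (W s * ∑ l, sobolevEnergy i (fun y ↦ fderiv ℝ (w p s) y
              (stdOrthonormalBasis ℝ E' l))) := lintegral_congr fun s ↦ by ring
            _ = A₂ p * Y p := lintegral_const_mul'' (A₂ p) (mWY p)
        have e3 : ∫⁻ s in Ioo 0 t, W s * (A₃ p * ∑ q, (sobolevEnergy i (w q s) +
            ∑ m, sobolevEnergy i (fun y ↦ fderiv ℝ (w q s) y (stdOrthonormalBasis ℝ E' m)))) =
            A₃ p * ∑ q, (Z q + Y q) := by
          have mqq : ∀ q, AEMeasurable (fun s ↦ W s * sobolevEnergy i (w q s) +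
              W s * ∑ m, sobolevEnergy i (fun y ↦ fderiv ℝ (w q s) y (stdOrthonormalBasis ℝ E' m)))
              (volume.restrict (Ioo 0 t)) := fun q ↦ (mWZ q).add (mWY q)
          have mq' : AEMeasurable (fun s ↦ ∑ q, (W s * sobolevEnergy i (w q s) +
              W s * ∑ m, sobolevEnergy i (fun y ↦ fderiv ℝ (w q s) y (stdOrthonormalBasis ℝ E' m))))
              (volume.restrict (Ioo 0 t)) := Finset.aemeasurable_fun_sum _ fun q _ ↦ mqq q
          calc _ = ∫⁻ s in Ioo 0 t, A₃ p * ∑ q, (W s * sobolevEnergy i (w q s) +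
                W s * ∑ m, sobolevEnergy i (fun y ↦ fderiv ℝ (w q s) y (stdOrthonormalBasis ℝ E' m))) := by
                refine lintegral_congr fun s ↦ ?_
                rw [Finset.mul_sum, Finset.mul_sum, Finset.mul_sum]
                refine Finset.sum_congr rfl fun q _ ↦ ?_
                ring
            _ = A₃ p * ∫⁻ s in Ioo 0 t, ∑ q, (W s * sobolevEnergy i (w q s) +
                W s * ∑ m, sobolevEnergy i (fun y ↦ fderiv ℝ (w q s) y (stdOrthonormalBasis ℝ E' m))) :=
                lintegral_const_mul'' (A₃ p) mq'
            _ = A₃ p * ∑ q, ∫⁻ s in Ioo 0 t, (W s * sobolevEnergy i (w q s) +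
                W s * ∑ m, sobolevEnergy i (fun y ↦ fderiv ℝ (w q s) y (stdOrthonormalBasis ℝ E' m))) := by
                rw [lintegral_finsetSum' _ fun q _ ↦ mqq q]
            _ = A₃ p * ∑ q, (Z q + Y q) := by
                congr 1
                refine Finset.sum_congr rfl fun q _ ↦ ?_
                rw [lintegral_add_left' (mWZ q)]
        have e4 : ∫⁻ s in Ioo 0 t, W s * (A₄ p * sobolevEnergy i (cutExpr P p (g s))) = A₄ p * G p := by
          calc _ = ∫⁻ s in Ioo 0 t, A₄ p * (W s * sobolevEnergy i (cutExpr P p (g s))) :=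
                lintegral_congr fun s ↦ by ring
            _ = A₄ p * G p := lintegral_const_mul'' (A₄ p) mWG
        rw [e1, e2, e3, e4]
  -- Step 2: sum over the patches and absorb
  set Rt : ℝ≥0∞ := ∑ p, R p with hRt
  set Gt : ℝ≥0∞ := ∑ p, G p with hGt
  have hRttop : Rt ≠ ⊤ := ENNReal.sum_ne_top.2 fun p _ ↦ hRtop p
  have hYR : ∑ p, Y p ≤ ENNReal.ofReal (lam⁻¹ / 2) * Rt := by
    rw [hRt, Finset.mul_sum]; exact Finset.sum_le_sum fun p _ ↦ hYle p
  have hZR : ∑ p, Z p ≤ ENNReal.ofReal (lam⁻¹ ^ 2) * Rt := by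
    rw [hRt, Finset.mul_sum]; exact Finset.sum_le_sum fun p _ ↦ hZle p
  have hXR : ∑ p, X p ≤ (Module.finrank ℝ E' : ℝ≥0∞) * Rt := by
    rw [hRt, Finset.mul_sum]; exact Finset.sum_le_sum fun p _ ↦ hXle p
  -- smallness of the coefficients
  have hc₁n : c₁ * (Module.finrank ℝ E' : ℝ≥0∞) ≤ 4⁻¹ := by
    rw [hc₁, ← ENNReal.ofReal_natCast, ← ENNReal.ofReal_mul (by positivity)]
    have h : 4 * (Module.finrank ℝ E' : ℝ) ^ 2 * η ^ 2 * (Module.finrank ℝ E' : ℝ) ≤ 4⁻¹ := by nlinarith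
    refine (ENNReal.ofReal_le_ofReal h).trans ?_
    rw [ENNReal.ofReal_inv_of_pos (by norm_num)]
    norm_num
  have hlamc : a₂ * ENNReal.ofReal (lam⁻¹ / 2) + a₃ * (ENNReal.ofReal (lam⁻¹ ^ 2) + ENNReal.ofReal (lam⁻¹ / 2)) ≤
      4⁻¹ := by
    have hl1 : ENNReal.ofReal (lam⁻¹ / 2) ≤ ENNReal.ofReal lam⁻¹ :=
      ENNReal.ofReal_le_ofReal (by linarith [inv_nonneg.2 hlam0.le])
    have hl2 : ENNReal.ofReal (lam⁻¹ ^ 2) ≤ ENNReal.ofReal lam⁻¹ := by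
      refine ENNReal.ofReal_le_ofReal ?_
      have h1 : lam⁻¹ ≤ 1 := inv_le_one_of_one_le₀ hlam1
      nlinarith [inv_nonneg.2 hlam0.le]
    calc a₂ * ENNReal.ofReal (lam⁻¹ / 2) + a₃ * (ENNReal.ofReal (lam⁻¹ ^ 2) + ENNReal.ofReal (lam⁻¹ / 2))
        ≤ a₂ * ENNReal.ofReal lam⁻¹ + a₃ * (ENNReal.ofReal lam⁻¹ + ENNReal.ofReal lam⁻¹) := by gcongr
      _ = ENNReal.ofReal lam⁻¹ * Kc := by rw [hKc]; ring
      _ = ENNReal.ofReal lam⁻¹ * ENNReal.ofReal Kc.toReal := by rw [ENNReal.ofReal_toReal hKctop]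
      _ = ENNReal.ofReal (lam⁻¹ * Kc.toReal) := by rw [ENNReal.ofReal_mul (inv_nonneg.2 hlam0.le)]
      _ ≤ ENNReal.ofReal 4⁻¹ := by
          refine ENNReal.ofReal_le_ofReal ?_
          rw [inv_mul_le_iff₀ hlam0]
          linarith [ENNReal.toReal_nonneg (a := Kc)]
      _ = 4⁻¹ := by rw [ENNReal.ofReal_inv_of_pos (by norm_num)]; norm_num
  -- the summed inequality
  have hsum : Rt ≤ 2⁻¹ * Rt + a₄ * Gt := by
    calc Rt = ∑ p, R p := hRt
      _ ≤ ∑ p, (c₁ * X p + A₂ p * Y p + A₃ p * ∑ q, (Z q + Y q) + A₄ p * G p) :=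
          Finset.sum_le_sum fun p _ ↦ hRle p
      _ = c₁ * ∑ p, X p + ∑ p, A₂ p * Y p + a₃ * ∑ q, (Z q + Y q) + ∑ p, A₄ p * G p := by
          rw [ha₃]
          simp only [Finset.sum_add_distrib, Finset.mul_sum, Finset.sum_mul]
      _ ≤ c₁ * ((Module.finrank ℝ E' : ℝ≥0∞) * Rt) + a₂ * ∑ p, Y p +
          a₃ * (∑ q, Z q + ∑ q, Y q) + a₄ * Gt := by
          refine add_le_add (add_le_add (add_le_add ?_ ?_) (le_of_eq ?_)) ?_
          · exact mul_le_mul' le_rfl hXR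
          · rw [Finset.mul_sum]; exact Finset.sum_le_sum fun p _ ↦ mul_le_mul' (hA₂le p) le_rfl
          · rw [Finset.sum_add_distrib]
          · rw [hGt, Finset.mul_sum]; exact Finset.sum_le_sum fun p _ ↦ mul_le_mul' (hA₄le p) le_rfl
      _ ≤ c₁ * ((Module.finrank ℝ E' : ℝ≥0∞) * Rt) + a₂ * (ENNReal.ofReal (lam⁻¹ / 2) * Rt) +
          a₃ * (ENNReal.ofReal (lam⁻¹ ^ 2) * Rt + ENNReal.ofReal (lam⁻¹ / 2) * Rt) + a₄ * Gt := by
          gcongr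
      _ = (c₁ * (Module.finrank ℝ E' : ℝ≥0∞) + (a₂ * ENNReal.ofReal (lam⁻¹ / 2) +
          a₃ * (ENNReal.ofReal (lam⁻¹ ^ 2) + ENNReal.ofReal (lam⁻¹ / 2)))) * Rt + a₄ * Gt := by ring
      _ ≤ (4⁻¹ + 4⁻¹) * Rt + a₄ * Gt := by gcongr
      _ = 2⁻¹ * Rt + a₄ * Gt := by
          have hq : (4⁻¹ : ℝ≥0∞) + 4⁻¹ = 2⁻¹ := by
            rw [← ENNReal.ofReal_ofNat 4, ← ENNReal.ofReal_ofNat 2,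
              ← ENNReal.ofReal_inv_of_pos (by norm_num), ← ENNReal.ofReal_inv_of_pos (by norm_num),
              ← ENNReal.ofReal_add (by norm_num) (by norm_num)]
            norm_num
          rw [hq]
  have hfin := ENNReal.le_of_le_half_mul_add hRttop hsum
  calc ∑ p, ∫⁻ s in Ioo 0 t, W s * sobolevEnergy i (slabResidual 1 T' (fun s ↦ cutExpr P p (v s)) s)
      = Rt := by rw [hRt]
    _ ≤ 2 * (a₄ * Gt) := hfin
    _ = 2 * a₄ * ∑ p, ∫⁻ s in Ioo 0 t, W s * sobolevEnergy i (cutExpr P p (g s)) := by rw [hGt, mul_assoc]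

end Main

section MaxReg

variable [IsManifold I ∞ M] [I.Boundaryless] [T2Space M] [MeasurableSpace E'] [BorelSpace E'] [FiniteDimensional ℝ F'] {T : ℝ}

/-- **Weighted maximal-regularity a priori estimate, uniform in sub-slabs.** For every
order `i` there are `Λ ≥ 1` and `C < ∞` such that for every `λ ≥ Λ`, every `T' ≤ T`, every solution `v` on `[0, T']`
(`v(0) = 0`) of the chart form of the linear system with source `g`, and every `t ∈ [0, T]`:
`Σ_p maxRegQ i λ w_p t ≤ C Σ_p ∫₀ᵗ e^{-2λs} E_i(cutExpr P p (g s))` and, for every `p`,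
`e^{-2λt} E_i(w_p(t)) ≤ C λ⁻¹ Σ_p ∫₀ᵗ e^{-2λs} E_i(cutExpr P p (g s))`.
[cite: Evans2010, §7.1.3] -/
theorem maxreg_apriori_le_explicit (hT : 0 < T) (i : ℕ) {S : ι → ℝ → E' → (E' →L[ℝ] E')}
    {𝔟 : ι → ℝ → E' → ((E' →L[ℝ] F') →L[ℝ] F')} {𝔠 : ι → ℝ → E' → (F' →L[ℝ] F')}
    (hS : ∀ p, ContDiffOn ℝ ∞ (uncurry (S p)) (Icc 0 T ×ˢ (P.chart p).target))
    (h𝔟 : ∀ p, ContDiffOn ℝ ∞ (uncurry (𝔟 p)) (Icc 0 T ×ˢ (P.chart p).target))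
    (h𝔠 : ∀ p, ContDiffOn ℝ ∞ (uncurry (𝔠 p)) (Icc 0 T ×ˢ (P.chart p).target)) {η : ℝ} (hη : 0 ≤ η)
    (hηS : ∀ p, ∀ s ∈ Icc 0 T, ∀ y ∈ closedBall (0 : E') (4 * P.r p), ‖S p s y - 1‖ ≤ η)
    (hsmall : 16 * (Module.finrank ℝ E' : ℝ) ^ 3 * η ^ 2 ≤ 1) :
    ∃ Λ : ℝ, 1 ≤ Λ ∧ ∀ {lam : ℝ}, Λ ≤ lam → ∀ {T' : ℝ}, 0 < T' → T' ≤ T → ∀ {v g : ℝ → M → F'},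
      (∀ p, ContDiffOn ℝ ∞ (uncurry fun s y ↦ v s ((P.chart p).inv y)) (Icc 0 T' ×ˢ (P.chart p).target)) →
      (∀ x, v 0 x = 0) →
      (∀ p, ContDiffOn ℝ ∞ (uncurry fun s y ↦ g s ((P.chart p).inv y)) (Icc 0 T' ×ˢ (P.chart p).target)) →
      (∀ p, ∀ s ∈ Icc 0 T', ∀ y ∈ (P.chart p).target,
        timeDerivWithin (Icc 0 T') (fun s y ↦ v s ((P.chart p).inv y)) s y =
          frameOp (S p s y) (𝔟 p s y) (𝔠 p s y) (fun y ↦ v s ((P.chart p).inv y)) y + g s ((P.chart p).inv y)) →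
      ∀ t ∈ Icc 0 T',
        (∑ p, maxRegQ i lam (fun s ↦ cutExpr P p (v s)) t ≤
          (((Module.finrank ℝ E' : ℝ≥0∞) + 2) * (32 * (Fintype.card ι : ℝ≥0∞))) * ∑ p, ∫⁻ s in Ioo 0 t, ENNReal.ofReal (Real.exp (-2 * lam * s)) * sobolevEnergy i (cutExpr P p (g s))) ∧
        ∀ p, ENNReal.ofReal (Real.exp (-2 * lam * t)) * sobolevEnergy i (cutExpr P p (v t)) ≤
          (((Module.finrank ℝ E' : ℝ≥0∞) + 2) * (32 * (Fintype.card ι : ℝ≥0∞))) * ENNReal.ofReal lam⁻¹ * ∑ p, ∫⁻ s in Ioo 0 t, ENNReal.ofReal (Real.exp (-2 * lam * s)) * sobolevEnergy i (cutExpr P p (g s)) := by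
  classical
  obtain ⟨Λ, hΛ, hC⟩ := linear_apriori_residual_le_explicit P hT i hS h𝔟 h𝔠 hη hηS hsmall
  set C : ℝ≥0∞ := 32 * (Fintype.card ι : ℝ≥0∞) with hCdef
  refine ⟨max Λ 1, le_max_right _ _, ?_⟩
  intro lam hlam T' hT' hT'T v g hv hv0 hg hchart t ht
  have hlamΛ : Λ ≤ lam := (le_max_left _ _).trans hlam
  have hlam1 : 1 ≤ lam := (le_max_right _ _).trans hlam
  have hlam0 : 0 < lam := by linarith
  have hap := hC hlamΛ hT' hT'T hv hv0 hg hchart t ht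
  set G := ∑ p, ∫⁻ s in Ioo 0 t, ENNReal.ofReal (Real.exp (-2 * lam * s)) * sobolevEnergy i (cutExpr P p (g s)) with hG
  have hw : ∀ p, IsSmoothSpaceTimeOn (Icc 0 T') fun s ↦ cutExpr P p (v s) := fun p ↦ isSmoothSpaceTimeOn_cutExpr P p (hv p)
  refine ⟨?_, fun p ↦ ?_⟩
  · calc ∑ p, maxRegQ i lam (fun s ↦ cutExpr P p (v s)) t
        ≤ ∑ p, ((Module.finrank ℝ E' : ℝ≥0∞) + 2) *
            ∫⁻ s in Ioo 0 t, ENNReal.ofReal (Real.exp (-2 * lam * s)) * sobolevEnergy i (slabResidual 1 T' (fun s ↦ cutExpr P p (v s)) s) :=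
          Finset.sum_le_sum fun p _ ↦ maxRegQ_le_residual hT' (hw p) (isCompact_closedBall (0 : E') (3 * P.r p))
            (fun s y hy ↦ cutExpr_family_eq_zero P p s hy) (cutExpr_family_zero P p hv0) hlam1 i ht
      _ = ((Module.finrank ℝ E' : ℝ≥0∞) + 2) *
            ∑ p, ∫⁻ s in Ioo 0 t, ENNReal.ofReal (Real.exp (-2 * lam * s)) * sobolevEnergy i (slabResidual 1 T' (fun s ↦ cutExpr P p (v s)) s) := by
          rw [Finset.mul_sum]
      _ ≤ ((Module.finrank ℝ E' : ℝ≥0∞) + 2) * (C * G) := mul_le_mul' le_rfl hap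
      _ = _ := by rw [hCdef]; ring
  · have hpt := weight_mul_sobolevEnergy_le_residual (ν := (1 : ℝ)) hT' one_pos (hw p) (isCompact_closedBall (0 : E') (3 * P.r p))
      (fun s y hy ↦ cutExpr_family_eq_zero P p s hy) (cutExpr_family_zero P p hv0) hlam0 i ht
    calc ENNReal.ofReal (Real.exp (-2 * lam * t)) * sobolevEnergy i (cutExpr P p (v t))
        ≤ ENNReal.ofReal lam⁻¹ * ∫⁻ s in Ioo 0 t, ENNReal.ofReal (Real.exp (-2 * lam * s)) *
            sobolevEnergy i (slabResidual 1 T' (fun s ↦ cutExpr P p (v s)) s) := hpt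
      _ ≤ ENNReal.ofReal lam⁻¹ * ∑ q, ∫⁻ s in Ioo 0 t, ENNReal.ofReal (Real.exp (-2 * lam * s)) *
            sobolevEnergy i (slabResidual 1 T' (fun s ↦ cutExpr P q (v s)) s) :=
          mul_le_mul' le_rfl (Finset.single_le_sum (f := fun q ↦ ∫⁻ s in Ioo 0 t, ENNReal.ofReal (Real.exp (-2 * lam * s)) *
            sobolevEnergy i (slabResidual 1 T' (fun s ↦ cutExpr P q (v s)) s)) (fun _ _ ↦ bot_le) (Finset.mem_univ p))
      _ ≤ ENNReal.ofReal lam⁻¹ * (C * G) := mul_le_mul' le_rfl hap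
      _ ≤ ((Module.finrank ℝ E' : ℝ≥0∞) + 2) * C * ENNReal.ofReal lam⁻¹ * G := by
          rw [show ENNReal.ofReal lam⁻¹ * (C * G) = 1 * C * ENNReal.ofReal lam⁻¹ * G by ring]
          gcongr
          exact le_add_left (by norm_num)

end MaxReg

end PatchSystemLoc

end Literature.Analysis.PDE
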